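import Summits.HodgeConjecture.HodgeConjecture.Theorems.Ring2HypothesesWeilTypeGeneralDischarged
import Literature.AlgebraicGeometry.HodgeTheory.WeilTypeGeneralMemberPowersHodgeConjecture
import HarnessLib

/-!
# Ring 2 — hypotheses layer, part XIII′: the PW0 BINDER LEDGER — Abdulali's power theorem is now a NAMED, REFEREED
# Literature fact, so the typed input `UsualHodgePowersOfGeneralWeilType` (PW0) is DISCHARGED modulo that one fact
# by name, and the eleven `hAbd` rows of parts XIII / XXX-C / XXXII rest on named Literature facts only

HONEST FRAMING: research route conditional on HC_CM; not a corollary; Q11.4-sentence-2 already refuted in dim ≥ 3.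

Cell `pub-hodge-ring2`, seat `ring2-b02` (gen 78), serving the retired hypotheses seat's standing plan item (part XIII
module docstring: "promotion to a Literature named fact is the Literature seat's call"; RING2-MAP `## §hypotheses gen 8`:
"the one-line discharge `usualHodgePowersOfGeneralWeilType_of_<fact>`") now that the Literature seat has SERVED it
(`Literature/AlgebraicGeometry/HodgeTheory/WeilTypeGeneralMemberPowersHodgeConjecture.lean`, seat `hodge-lit-weilregime`).
`HC_CM` is ALWAYS the binder `(hCM : Theses.RankFourFaces.CMAbelianHodge)` (stmt-HodgeConjecture-3052), never an axiom,
never cited as known; it occurs in ONE row (8A), nominally, exactly as in parts XIII / XXXII. THEOREMS ONLY (no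
definition, no named fact minted here, no sorry; axioms `propext`, `Classical.choice`, `Quot.sound`). Nothing here
proves a new case of the Hodge conjecture: every row is an implication between NAMED typed statements of the tree.

## Why this file exists (count once)

Part XIII (`Ring2HypothesesWeilPowers`) typed the ONE missing input of the general-member POWER cells of the Weil atlas
as the HYPOTHESIS PW0 `UsualHodgePowersOfGeneralWeilType` — "for `(A, ℚ(φ))` of Weil type `(n,n)` with `Hg = SU_H`, the
usual Hodge conjecture for `A` implies it for every power `A^{N+1}`" (Abdulali, IJM 10 (1999) Thm. 3.1 = JPAA 216 (2012)
Thm. 5, second sentence) — because the primary source was not held; eleven kernel rows (XIII PW1–PW5 / PW4′, XXX-C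
L3–L5, and their 6.12-free twins of part XXXII) carry the binder `(hAbd : UsualHodgePowersOfGeneralWeilType)`. The
Literature seat has since VENDORED the printed theorem as the named fact
`Abdulali1999_hodgeClasses_algebraic_powSucc_of_hasHodgeGroupSU` (binders VERBATIM PW0's with `2 ≤ n` — the Abdulali
reading `End⁰(A) = K`, `L(A) = U_H` needs `n ≥ 2`; GRADE refereed; faithfulness sheet in that module: weaker than print,
never stronger) and PROVED PW0's body on the WHOLE binder range `0 < n` from it
(`hodgeConjectureFor_powSucc_of_hasHodgeGroupSU_of_pos`: at `n = 1` every power of every abelian SURFACE satisfies the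
statement outright — Moonen–Zarhin 1999 §2, Tate / van Geemen 4.3 —, at `n ≥ 2` the fact verbatim). Landed signatures
are never edited in place (the paper's by-name index and every call site would break), so — exactly as for the Landherr
binder (part XXX-C) and the 6.12 binder (part XXXII) — PW0 gets its discharge theorem and each `hAbd` row an ADDITIVE
twin `<name>_abdulali` with the SAME statement, `hAbd : UsualHodgePowersOfGeneralWeilType` replaced by the named
Literature fact; the earlier theorems stay as they are (each is its twin composed with §1).

## Ledger

| # | this file | twin of (part) | inputs left (all BY NAME) |
|---|---|---|---|
| 0 | `usualHodgePowersOfGeneralWeilType_of_abdulali`, `abdulali1999_of_usualHodgePowersOfGeneralWeilType`, `usualHodgePowersOfGeneralWeilType_iff_abdulali1999` | XIII PW0 | **PW0 ⟺ the vendored fact** (EXACTNESS of the typing: the `n = 1` surplus of PW0's binder is a theorem of the tree) |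
| EX | `hodgePowersOfGeneralWeilTypeComponent_iff_abdulali` | XIII EX | Abdulali (refereed): **the general-member POWER cell of `(ℚ(√-d), 2n, δ)` IS its `X`-cell, modulo a refereed theorem in print, vendored** |
| 7A | `hodgePowersOfGeneralWeilTypeComponent_of_weilClassesComponent_abdulali` | XIII PW2 ∕ XXXII row 7 | Abdulali, `W(δ)` |
| 8A | `HC_PowersOfGeneralWeilTypeComponent_of_HC_CM_abdulali` | XIII PW3 ∕ XXXII row 8 | `HC_CM` (nominal), Abdulali, CM-pointed δ-families, `VHC(δ)` |
| 9A | `hodgePowersOfGeneralWeilTypeComponent_of_divisorGeneratedCMPointed_abdulali` | XIII PW3′ ∕ XXXII row 9 | Abdulali, div-gen CM-pointed δ-families, `VHC(δ)` |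
| 9B | `hodgePowersOfGeneralWeilTypeComponent_of_cmPowerPointed_abdulali` | power companion of VIII W6‴ ∕ XXXII row 6 (new row) | Abdulali, CM-power-pointed δ-families (anchor validated by Tate), `VHC(δ)` |
| 10A | `hodgePowersOfGeneralWeilTypeComponent_two_of_refereed_one_or_three_abdulali` | XIII PW4 ∕ XXXII row 10 | **Abdulali, Koike 2004, Schoen 1998 — THREE REFEREED FACTS, nothing else**: survey App. A 1(b)(i), every power of the GENERAL Weil fourfold over `ℚ(i)` ∕ `ℚ(√-3)`, every δ |
| 15A | `hodgePowersOfGeneralWeilTypeComponent_split_three_three_of_schoen_abdulali` | XXX-C L3 ∕ XXXII row 15 | **Abdulali, Schoen 1998 (refereed)**: App. A 1(b)(ii) over `ℚ(√-3)` |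
| 16A | `hodgePowersOfGeneralWeilTypeComponent_split_three_one_of_koike_abdulali` | XXX-C L4 ∕ XXXII row 16 | **Abdulali, Koike 2004 (refereed)**: App. A 1(b)(ii) over `ℚ(i)` |
| 14A | `hodgePowersOfGeneralWeilTypeComponent_two_of_markmanFourfolds_abdulali` | XIII PW4′ ∕ XXXII row 14 | Abdulali + F1 Markman 2025 Cor. 1.6.1 (UNREFEREED): every fourfold component, every δ |
| 17A | `hodgePowersOfGeneralWeilTypeComponent_split_three_of_markmanSixfolds_abdulali` | XXX-C L5 ∕ XXXII row 17 | Abdulali + F2 Markman 2025 Thm. 1.5.1 (UNREFEREED): split sixfolds, every `d` |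
| audit | `abdulali_binder_ledger`, `abdulali1999_of_hodgeAbelianVarieties` | XXXII `thm612_binder_ledger` | the conjunction; ON-PATH from `HC_AV` |

After this file the LIVE typed-hypothesis binders on the general-member power rows of the hypotheses axis are 0: every
input of rows 7A–17A is a NAMED LITERATURE FACT — refereed (Abdulali 1999/2012, Schoen 1998, Koike 2004; van Geemen
6.12 and Landherr's criterion are THEOREMS of the tree) or flagged unrefereed (Markman 2025 F1 ∕ F2) —, an OPEN
δ-statement of the tree (`WeilClassesComponent`, `WeilVariationalHodgeComponent`, the CM-pointed family leaves) or
`HC_CM` (nominal, row 8A only). HONEST COLUMN, unchanged from part XIII: (i) PW0 ∕ Abdulali speak of GENERAL members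
(`Hg = SU_H`) only — the special members of the atlas power cell `Ring2.Atlas.HodgePowersOfWeilTypeFourfold` (CM members,
`E_k × Y₃`, larger endomorphism algebra) are not touched, so that ALL-member cell is NOT discharged here (δ = 1:
Floccari–Fu, all members, refereed, `Ring2.Atlas.hodgePowersOfDiscOneWeilFourfold_of_floccariFu`); (ii) rows 10A ∕ 15A ∕
16A are kernel renderings of cells listed as KNOWN in print (Abdulali 2016 App. A 1(b)); WHAT THE KERNEL ROWS ADD about
Hodge classes: NOTHING new — implications between named statements; (iii) the vendored fact is WEAKER than print (usual,
not general, Hodge conjecture for the powers; the sub-class `Hg = SU_H` of the printed PEL-type class), never stronger —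
see the faithfulness sheet of the Literature module; its primary locus IJM 10 (1999) is still NOT HELD (acq-04934) and
is cited through the two held restatements (JPAA 2012 Thm. 5 with proof; LMS LN 427 App. A).

References: [Abdulali1999TypeIII] S. Abdulali, IJM 10 (1999) 667–675, Thm. 3.1 (p. 671); [Abdulali2012TateTwistsIV]
JPAA 216 (2012) 1164–1170 = arXiv:1203.4857, Thm. 5 and its proof; [Abdulali2016TateTwists] LMS LN 427 (2016), Thm. 4.1,
App. A 1(b); [vanGeemen1994HodgeAV] LNM 1594, Thm. 4.3, Thm. 6.11–6.12, (5.4.1), 5.5; [Schoen1998HodgeWeilAddendum]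
Compositio 114 (1998) Theorem p. 329; [Koike2004WeilHodge] CMB 47 (2004) Thm. 2.1, Cor. 2.1; [Markman2025SecantWeil]
arXiv:2502.03415 (UNREFEREED) Thm. 1.5.1, Cor. 1.6.1; [MoonenZarhin1999LowDim] Duke 97 (1999) §2, Thm. 0.1;
[CharlesSchnell2014Notes] Conj. 11.3.1; [Deligne2000] §1.
-/

noncomputable section

namespace Summit.HodgeConjecture.HodgeConjecture.Ring2.Hypotheses

set_option linter.dupNamespace false -- the cell's namespace repeats the summit name, as in every `Ring2*` file

open CategoryTheory
open Literature.AlgebraicGeometry Literature.AlgebraicGeometry.Motives Literature.AlgebraicGeometry.VanGeemen1994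
open Literature.AlgebraicGeometry.HodgeTheory
open Literature.AlgebraicTopology.SingularHomology
open Summit.HodgeConjecture.HodgeConjecture.WeilTypeLadder
open Summit.HodgeConjecture.HodgeConjecture.Theses
open Summit.HodgeConjecture.HodgeConjecture.Ring2Transport

variable {n d : ℕ} {δ : weilNormResidueGroup d}

/-! ### §1 PW0 discharged modulo the one named fact, and the EXACTNESS of the typing -/

/-- **PW0 DISCHARGED — `UsualHodgePowersOfGeneralWeilType` holds modulo ONE named, REFEREED Literature fact BY NAME**:
Abdulali's power theorem `Abdulali1999_hodgeClasses_algebraic_powSucc_of_hasHodgeGroupSU` (IJM 10 (1999) Thm. 3.1 =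
JPAA 216 (2012) Thm. 5, second sentence, vendored on the sub-class `Hg = SU_H`, `n ≥ 2`) gives PW0 on its whole binder
range `0 < n` — the Literature theorem `hodgeConjectureFor_powSucc_of_hasHodgeGroupSU_of_pos` (at `n = 1`: every power
of every abelian surface, outright). This is the "one-line discharge" planned in part XIII's docstring; PW0's ON-PATH
theorems (`…_of_hodgeAbelianVarieties`, `…_of_hodgeConjecture`) are unaffected.
[cite: Abdulali2012TateTwistsIV, Thm. 5 (second sentence) and its proof] [cite: Abdulali1999TypeIII, Thm. 3.1 (p. 671)]
[cite: MoonenZarhin1999LowDim, §2 p. 715 and Thm. 0.1 (4)] -/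
theorem usualHodgePowersOfGeneralWeilType_of_abdulali
    (hAbd : Abdulali1999_hodgeClasses_algebraic_powSucc_of_hasHodgeGroupSU) : UsualHodgePowersOfGeneralWeilType :=
  hodgeConjectureFor_powSucc_of_hasHodgeGroupSU_of_pos hAbd

/-- Conversely PW0 (binder `0 < n`) contains the vendored fact (binder `2 ≤ n`) — a restriction of range.
[cite: Abdulali2012TateTwistsIV, Thm. 5] -/
theorem abdulali1999_of_usualHodgePowersOfGeneralWeilType (h : UsualHodgePowersOfGeneralWeilType) :
    Abdulali1999_hodgeClasses_algebraic_powSucc_of_hasHodgeGroupSU :=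
  fun A φ n d e a hn hd hA hφ hW ha ha0 hSU hHC N ↦ h A φ n d e a (by omega) hd hA hφ hW ha ha0 hSU hHC N

/-- **EXACTNESS OF THE TYPING — PW0 ⟺ the vendored refereed fact**: the typed hypothesis of part XIII is, in the
kernel, EQUIVALENT to Abdulali's theorem as vendored; the `n = 1` surplus of PW0's binder (referee F40: Weil-type
abelian SURFACES, not covered by the Abdulali reading) is a theorem of the tree (`hodgeConjectureFor_powSucc_of_surface`),
so it costs nothing. [cite: Abdulali2012TateTwistsIV, Thm. 5] [cite: Abdulali1999TypeIII, Thm. 3.1 (p. 671)]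
[cite: MoonenZarhin1999LowDim, §2 p. 715] -/
theorem usualHodgePowersOfGeneralWeilType_iff_abdulali1999 :
    UsualHodgePowersOfGeneralWeilType ↔ Abdulali1999_hodgeClasses_algebraic_powSucc_of_hasHodgeGroupSU :=
  ⟨abdulali1999_of_usualHodgePowersOfGeneralWeilType, usualHodgePowersOfGeneralWeilType_of_abdulali⟩

/-- **EX modulo the named fact — the general-member POWER cell of `(ℚ(√-d), 2n, δ)` IS its general-member `X`-cell**
(part VII-B's `HodgeGeneralWeilTypeComponent`), now modulo a refereed theorem in print, vendored, BY NAME: powers add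
NO open input on this sub-cell. Twin of `hodgePowersOfGeneralWeilTypeComponent_iff`.
[cite: Abdulali2016TateTwists, Thm. 4.1] [cite: Abdulali2012TateTwistsIV, Thm. 5] [cite: vanGeemen1994HodgeAV, Thm. 6.12] -/
theorem hodgePowersOfGeneralWeilTypeComponent_iff_abdulali
    (hAbd : Abdulali1999_hodgeClasses_algebraic_powSucc_of_hasHodgeGroupSU) (hn : 0 < n) (hd : 0 < d) :
    HodgePowersOfGeneralWeilTypeComponent n d δ ↔ HodgeGeneralWeilTypeComponent n d δ :=
  hodgePowersOfGeneralWeilTypeComponent_iff (usualHodgePowersOfGeneralWeilType_of_abdulali hAbd) hn hd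

/-! ### §2 The general-member power rows on named Literature facts — twins `_abdulali` of part XXXII rows 7–17 -/

/-- **Row 7A — PW2 on named facts: the component's Weil-class target `W(δ)` gives its general-member power cell**,
modulo Abdulali BY NAME (6.12 is a theorem; part XXXII row 7). [cite: vanGeemen1994HodgeAV, Thm. 4.11 and Thm. 6.12]
[cite: Abdulali2016TateTwists, Thm. 4.1] [cite: Abdulali2012TateTwistsIV, Thm. 5] -/
theorem hodgePowersOfGeneralWeilTypeComponent_of_weilClassesComponent_abdulali
    (hAbd : Abdulali1999_hodgeClasses_algebraic_powSucc_of_hasHodgeGroupSU) (hn : 0 < n) (hd : 0 < d)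
    (hW : WeilClassesComponent n d δ) : HodgePowersOfGeneralWeilTypeComponent n d δ :=
  hodgePowersOfGeneralWeilTypeComponent_of_weilClassesComponent_discharged
    (usualHodgePowersOfGeneralWeilType_of_abdulali hAbd) hn hd hW

/-- **Row 8A — PW3 `HC_<powers of the general member of (K, 2n, δ)>_of_HC_CM` on named facts** (`HC_CM` a binder BY
NAME, NOMINAL: rows 9A ∕ 9B drop it). CONDITIONAL on `HC_CM`, the CM-pointed δ-families and the δ-restricted
variational statement. [cite: vanGeemen1994HodgeAV, Thm. 6.12 and 5.5] [cite: Abdulali2016TateTwists, Thm. 4.1]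
[cite: CharlesSchnell2014Notes, Conj. 11.3.1] -/
theorem HC_PowersOfGeneralWeilTypeComponent_of_HC_CM_abdulali (hCM : Theses.RankFourFaces.CMAbelianHodge)
    (hAbd : Abdulali1999_hodgeClasses_algebraic_powSucc_of_hasHodgeGroupSU) (hn : 0 < n) (hd : 0 < d)
    (hP : CMPointedWeilFamiliesComponent n d δ) (hV : WeilVariationalHodgeComponent n d δ) :
    HodgePowersOfGeneralWeilTypeComponent n d δ :=
  HC_PowersOfGeneralWeilTypeComponent_of_HC_CM_discharged hCM (usualHodgePowersOfGeneralWeilType_of_abdulali hAbd) hn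
    hd hP hV

/-- **Row 9A — PW3′ WITHOUT `HC_CM`, on named facts** (divisor-generated CM-pointed δ-families).
[cite: vanGeemen1994HodgeAV, Thm. 6.12 and 5.5] [cite: Abdulali2016TateTwists, Thm. 4.1] -/
theorem hodgePowersOfGeneralWeilTypeComponent_of_divisorGeneratedCMPointed_abdulali
    (hAbd : Abdulali1999_hodgeClasses_algebraic_powSucc_of_hasHodgeGroupSU) (hn : 0 < n) (hd : 0 < d)
    (hP : DivisorGeneratedCMPointedWeilFamiliesComponent n d δ) (hV : WeilVariationalHodgeComponent n d δ) :
    HodgePowersOfGeneralWeilTypeComponent n d δ :=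
  hodgePowersOfGeneralWeilTypeComponent_of_divisorGeneratedCMPointed_discharged
    (usualHodgePowersOfGeneralWeilType_of_abdulali hAbd) hn hd hP hV

/-- **Row 9B — the power cell from CM-POWER-pointed δ-families, WITHOUT `HC_CM`, on named facts** (the anchor fibre of
`E_Kⁿ × E_Kⁿ`-type is validated by Tate's theorem, part VIII `weilClassesComponent_of_cmPowerPointed`; then the
δ-restricted variational statement, 6.12 proved, Abdulali). The power-cell companion of part XXXII row 6.
[cite: vanGeemen1994HodgeAV, Thm. 6.12 and Thm. 4.3] [cite: Abdulali2016TateTwists, Thm. 4.1] -/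
theorem hodgePowersOfGeneralWeilTypeComponent_of_cmPowerPointed_abdulali
    (hAbd : Abdulali1999_hodgeClasses_algebraic_powSucc_of_hasHodgeGroupSU) (hn : 0 < n) (hd : 0 < d)
    (hP : CMPowerPointedWeilFamiliesComponent n d δ) (hV : WeilVariationalHodgeComponent n d δ) :
    HodgePowersOfGeneralWeilTypeComponent n d δ :=
  hodgePowersOfGeneralWeilTypeComponent_of_weilClassesComponent_abdulali hAbd hn hd
    (weilClassesComponent_of_cmPowerPointed hP hV)

/-- **Row 10A — survey App. A 1(b)(i) on THREE REFEREED NAMED FACTS and nothing else: the Hodge conjecture for every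
power of the GENERAL abelian fourfold of Weil type over `ℚ(i)` or `ℚ(√-3)`, EVERY discriminant δ** — Koike 2004 ∕
Schoen 1998 (the habitat seat's refereed fourfold cells, via the `6 ⟹ 4` transfer) and Abdulali 1999/2012, BY NAME; no
`HC_CM`, no Landherr, no 6.12 binder, no typed hypothesis. (δ = 1 is dominated by Floccari–Fu, all members.)
[cite: Abdulali2016TateTwists, App. A 1(b)(i) and Thm. 4.1] [cite: Schoen1998HodgeWeilAddendum, Theorem (p. 329)]
[cite: Koike2004WeilHodge, Remark 2.1] [cite: Abdulali2012TateTwistsIV, Thm. 5] -/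
theorem hodgePowersOfGeneralWeilTypeComponent_two_of_refereed_one_or_three_abdulali
    (hAbd : Abdulali1999_hodgeClasses_algebraic_powSucc_of_hasHodgeGroupSU)
    (hK : Koike2004_weilClasses_algebraic_hyperbolicSixfold_one)
    (hS : Schoen1998_weilClasses_algebraic_hyperbolicSixfold_three) {d : ℕ} (hd13 : d = 1 ∨ d = 3)
    (δ : weilNormResidueGroup d) : HodgePowersOfGeneralWeilTypeComponent 2 d δ :=
  hodgePowersOfGeneralWeilTypeComponent_two_of_refereed_one_or_three_discharged
    (usualHodgePowersOfGeneralWeilType_of_abdulali hAbd) hK hS hd13 δ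

/-- **Row 15A — App. A 1(b)(ii), `K = ℚ(√-3)`, on TWO REFEREED NAMED FACTS: every power of the GENERAL SPLIT
(`det H = -1`) abelian sixfold of Weil type over `ℚ(√-3)`** — Schoen 1998 and Abdulali, BY NAME (Landherr's criterion
and 6.12 are theorems). [cite: Abdulali2016TateTwists, App. A 1(b)(ii) and Thm. 4.1] [cite: Schoen1998HodgeWeilAddendum]
[cite: Abdulali2012TateTwistsIV, Thm. 5] -/
theorem hodgePowersOfGeneralWeilTypeComponent_split_three_three_of_schoen_abdulali
    (hAbd : Abdulali1999_hodgeClasses_algebraic_powSucc_of_hasHodgeGroupSU)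
    (hS : Schoen1998_weilClasses_algebraic_hyperbolicSixfold_three) :
    HodgePowersOfGeneralWeilTypeComponent 3 3 (splitDiscriminantClass 3 3) :=
  hodgePowersOfGeneralWeilTypeComponent_split_three_three_of_schoen'_discharged
    (usualHodgePowersOfGeneralWeilType_of_abdulali hAbd) hS

/-- **Row 16A — App. A 1(b)(ii), `K = ℚ(i)`, on TWO REFEREED NAMED FACTS: every power of the GENERAL SPLIT abelian
sixfold of Weil type over `ℚ(i)`** — Koike 2004 and Abdulali, BY NAME.
[cite: Abdulali2016TateTwists, App. A 1(b)(ii) and Thm. 4.1] [cite: Koike2004WeilHodge, Thm. 2.1 and Cor. 2.1]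
[cite: Abdulali2012TateTwistsIV, Thm. 5] -/
theorem hodgePowersOfGeneralWeilTypeComponent_split_three_one_of_koike_abdulali
    (hAbd : Abdulali1999_hodgeClasses_algebraic_powSucc_of_hasHodgeGroupSU)
    (hK : Koike2004_weilClasses_algebraic_hyperbolicSixfold_one) :
    HodgePowersOfGeneralWeilTypeComponent 3 1 (splitDiscriminantClass 3 1) :=
  hodgePowersOfGeneralWeilTypeComponent_split_three_one_of_koike'_discharged
    (usualHodgePowersOfGeneralWeilType_of_abdulali hAbd) hK

/-- **Row 14A — every fourfold component `(ℚ(√-d), 4, δ)`: powers of the general member, from the UNREFEREED floor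
fact F1** (Markman 2025, all Weil-type abelian fourfolds, BY NAME) and Abdulali (refereed).
[cite: Markman2025SecantWeil, Cor. 1.6.1 (preprint, unrefereed)] [cite: Abdulali2016TateTwists, Thm. 4.1]
[cite: Abdulali2012TateTwistsIV, Thm. 5] -/
theorem hodgePowersOfGeneralWeilTypeComponent_two_of_markmanFourfolds_abdulali
    (hAbd : Abdulali1999_hodgeClasses_algebraic_powSucc_of_hasHodgeGroupSU)
    (hM : Markman2025_weilClasses_algebraic_abelianFourfold) {d : ℕ} (hd : 0 < d) (δ : weilNormResidueGroup d) :
    HodgePowersOfGeneralWeilTypeComponent 2 d δ :=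
  hodgePowersOfGeneralWeilTypeComponent_two_of_markmanFourfolds_discharged
    (usualHodgePowersOfGeneralWeilType_of_abdulali hAbd) hM hd δ

/-- **Row 17A — split sixfolds, every `d`: powers of the general member, from the UNREFEREED floor fact F2** (Markman
2025 Thm. 1.5.1, BY NAME) and Abdulali (refereed); Landherr and 6.12 are theorems.
[cite: Markman2025SecantWeil, Thm. 1.5.1 (preprint, unrefereed)] [cite: Abdulali2016TateTwists, Thm. 4.1]
[cite: Abdulali2012TateTwistsIV, Thm. 5] -/
theorem hodgePowersOfGeneralWeilTypeComponent_split_three_of_markmanSixfolds_abdulali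
    (hAbd : Abdulali1999_hodgeClasses_algebraic_powSucc_of_hasHodgeGroupSU)
    (hM : Markman2025_weilClasses_algebraic_hyperbolicSixfold) {d : ℕ} (hd : 0 < d) :
    HodgePowersOfGeneralWeilTypeComponent 3 d (splitDiscriminantClass 3 d) :=
  hodgePowersOfGeneralWeilTypeComponent_split_three_of_markmanSixfolds'_discharged
    (usualHodgePowersOfGeneralWeilType_of_abdulali hAbd) hM hd

/-! ### §3 Audit -/

/-- **PW0 BINDER LEDGER, audit**: PW0 ⟺ the vendored fact; modulo the fact the power cell ≡ the `X`-cell on every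
component; the Weil-class engine, the three refereed power cells (App. A 1(b)(i), 1(b)(ii) ×2) and the two floor-fact
cells hold with NO typed hypothesis — every antecedent below is a NAMED LITERATURE FACT.
[cite: Abdulali2012TateTwistsIV, Thm. 5] [cite: Abdulali2016TateTwists, Thm. 4.1 and App. A 1(b)] -/
theorem abdulali_binder_ledger :
    (UsualHodgePowersOfGeneralWeilType ↔ Abdulali1999_hodgeClasses_algebraic_powSucc_of_hasHodgeGroupSU) ∧
      (Abdulali1999_hodgeClasses_algebraic_powSucc_of_hasHodgeGroupSU → ∀ (n d : ℕ) (δ : weilNormResidueGroup d),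
        0 < n → 0 < d → (HodgePowersOfGeneralWeilTypeComponent n d δ ↔ HodgeGeneralWeilTypeComponent n d δ)) ∧
      (Abdulali1999_hodgeClasses_algebraic_powSucc_of_hasHodgeGroupSU → ∀ (n d : ℕ) (δ : weilNormResidueGroup d),
        0 < n → 0 < d → WeilClassesComponent n d δ → HodgePowersOfGeneralWeilTypeComponent n d δ) ∧
      (Abdulali1999_hodgeClasses_algebraic_powSucc_of_hasHodgeGroupSU →
        Koike2004_weilClasses_algebraic_hyperbolicSixfold_one →
          Schoen1998_weilClasses_algebraic_hyperbolicSixfold_three →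
            ∀ d : ℕ, d = 1 ∨ d = 3 → ∀ δ : weilNormResidueGroup d, HodgePowersOfGeneralWeilTypeComponent 2 d δ) ∧
      (Abdulali1999_hodgeClasses_algebraic_powSucc_of_hasHodgeGroupSU →
        Schoen1998_weilClasses_algebraic_hyperbolicSixfold_three →
          HodgePowersOfGeneralWeilTypeComponent 3 3 (splitDiscriminantClass 3 3)) ∧
      (Abdulali1999_hodgeClasses_algebraic_powSucc_of_hasHodgeGroupSU →
        Koike2004_weilClasses_algebraic_hyperbolicSixfold_one →
          HodgePowersOfGeneralWeilTypeComponent 3 1 (splitDiscriminantClass 3 1)) ∧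
      (Abdulali1999_hodgeClasses_algebraic_powSucc_of_hasHodgeGroupSU →
        Markman2025_weilClasses_algebraic_abelianFourfold →
          ∀ d : ℕ, 0 < d → ∀ δ : weilNormResidueGroup d, HodgePowersOfGeneralWeilTypeComponent 2 d δ) ∧
      (Abdulali1999_hodgeClasses_algebraic_powSucc_of_hasHodgeGroupSU →
        Markman2025_weilClasses_algebraic_hyperbolicSixfold →
          ∀ d : ℕ, 0 < d → HodgePowersOfGeneralWeilTypeComponent 3 d (splitDiscriminantClass 3 d)) :=
  ⟨usualHodgePowersOfGeneralWeilType_iff_abdulali1999,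
    fun hAbd _ _ _ hn hd ↦ hodgePowersOfGeneralWeilTypeComponent_iff_abdulali hAbd hn hd,
    fun hAbd _ _ _ hn hd hW ↦ hodgePowersOfGeneralWeilTypeComponent_of_weilClassesComponent_abdulali hAbd hn hd hW,
    fun hAbd hK hS _ hd13 δ ↦
      hodgePowersOfGeneralWeilTypeComponent_two_of_refereed_one_or_three_abdulali hAbd hK hS hd13 δ,
    fun hAbd hS ↦ hodgePowersOfGeneralWeilTypeComponent_split_three_three_of_schoen_abdulali hAbd hS,
    fun hAbd hK ↦ hodgePowersOfGeneralWeilTypeComponent_split_three_one_of_koike_abdulali hAbd hK,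
    fun hAbd hM _ hd δ ↦ hodgePowersOfGeneralWeilTypeComponent_two_of_markmanFourfolds_abdulali hAbd hM hd δ,
    fun hAbd hM _ hd ↦ hodgePowersOfGeneralWeilTypeComponent_split_three_of_markmanSixfolds_abdulali hAbd hM hd⟩

/-- ON-PATH, audit: the vendored fact, like PW0, is a case of `HC_AV` (every `A^{N+1}` is an abelian variety) — an
upper bound, recorded so that the by-name index lists the fact under the summit's leaves. [cite: Deligne2000, §1] -/
theorem abdulali1999_of_hodgeAbelianVarieties (h : PadicSemiregularLift.HodgeAbelianVarieties) :
    Abdulali1999_hodgeClasses_algebraic_powSucc_of_hasHodgeGroupSU :=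
  abdulali1999_of_usualHodgePowersOfGeneralWeilType (usualHodgePowersOfGeneralWeilType_of_hodgeAbelianVarieties h)

end Summit.HodgeConjecture.HodgeConjecture.Ring2.Hypotheses

end
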